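import Summits.ResolutionOfSingularities.ResolutionOfSingularities.Theorems.ValuativeLuAlphaPTorsorPerronMonomializationHelpers
import HarnessLib

/-!
# Perron monomialization on a very good chart, II: the new chart `(R[x'], x')` (stub S3)

Crux `Valuative.LuAlphaPTorsor` (item `stmt-ResolutionOfSingularities-0641`), line
`pfaff-line-log-final-forms`, registered stub `stub_perronMonomialization` (S3): Zariski–Perron
MONOMIALIZATION on a very good chart in RANK ONE (= Cutkosky 2022, Thm. 1.2 (1), without
completions), the engine of the purely inseparable tower climbed by the line.

A very good chart is a finitely generated `k`-subalgebra `R ⊆ O` of `K` with non-zero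
`x₁, …, xₙ ∈ R` generating the centre `𝔪_O ∩ R` and with `ℤ`-independent values `v(xᵢ)`.
Given finitely many non-zero `aⱼ ∈ R` and Laurent exponents `h_l` with `v(x^{h_l}) ≤ 1`, the
stub produces a very good chart `(R' = R[x'], x')`, `R ≤ R' ⊆ Frac R`, with the `xᵢ` monomials
in the `x'ⱼ`, each `aⱼ` a monomial in `x'` times an element of `R'` of value `1`, and each
`x^{h_l}` a monomial in `x'`. Proof:

1. dominant forms `aⱼ = ∑ c_μ x^μ` with a strict maximiser `μ₀ⱼ` of unit coefficient
   (`stub_perronDominantTerm`, file `…PerronMonomializationHelpers.lean`);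
2. Knaf–Kuhlmann 2005, Lemma 4.2 (`knafKuhlmann2005_lemma42_matrix`, PROVED in the tree) for
   `τ = v ∘ x` and the finite set `H` of the differences `μ − μ₀ⱼ`, the `μ₀ⱼ`, the `h_l` and
   the unit vectors: `C ∈ GLₙ(ℤ)` with `v(x^{Cⱼ}) < 1` and every `h ∈ H` an `ℕ`-combination
   of the rows; `x'ⱼ := x^{Cⱼ}` (`perron_prod_zpow_eq_prod_pow` turns `x^h`, `h ∈ H`, into
   monomials in `x'`), `R' := k[R, x']` (`≤ O`, finitely generated, inside `Frac R`);
3. the centre of `R'` is `(x')R'` (`perron_span_eq_centre`: every `z ∈ R[x']` is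
   `r + ∑ x'ⱼ bⱼ`, and `v(z) < 1 ⇒ v(r) < 1 ⇒ r ∈ (x)R ⊆ (x')R'`), the `v(x'ⱼ)` are
   `ℤ`-independent (`perron_valIndep_of_matrix`, `C` is invertible), and
   `aⱼ = x^{μ₀ⱼ} · ∑ c_μ x^{μ − μ₀ⱼ}` with the sum in `R'` of value `1`
   (`perron_exists_monomial_mul_unit`).

## Sources

S. D. Cutkosky, *Local uniformization of Abhyankar valuations*, Michigan Math. J. 71 (2022),
Thm. 1.2 (1); H. Knaf, F.-V. Kuhlmann, *Abhyankar places admit local uniformization in any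
characteristic*, Ann. Sci. ÉNS 38 (2005), Lemma 4.2 and proof of Thm. 4.1.
-/

-- single-problem summit: the doubled namespace component `ResolutionOfSingularities` is forced
set_option linter.dupNamespace false

namespace Summit.ResolutionOfSingularities.ResolutionOfSingularities.Theorems.PfaffLine

open IsLocalRing Literature.AlgebraicGeometry.Resolution

section Chart

variable {k K : Type} [Field k] [Field K] [Algebra k K] (O : ValuationSubring K)

/-- A monomial `∏ yⱼ ^ dⱼ` with some `dⱼ ≠ 0` lies in the ideal generated by the `yⱼ`.
[folklore] -/
theorem perron_prod_pow_mem_span {A : Type*} [CommSemiring A] {ι : Type*} [Fintype ι] (y : ι → A)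
    (d : ι → ℕ) {j : ι} (hj : d j ≠ 0) : (∏ i, y i ^ (d i)) ∈ Ideal.span (Set.range y) := by
  classical
  rw [← Finset.mul_prod_erase Finset.univ _ (Finset.mem_univ j)]
  exact Ideal.mul_mem_right _ _
    (Ideal.pow_mem_of_mem _ (Ideal.subset_span (Set.mem_range_self j)) _ (Nat.pos_of_ne_zero hj))

/-- **The centre of `R[x']`.** Let `(R, x)` be a chart whose centre is generated by the `xᵢ`,
and `R' = R[x'₁, …, x'ₘ]` with `v(x'ⱼ) < 1` and every `xᵢ` in the ideal `(x')R'`. Then the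
centre of `R'` is generated by the `x'ⱼ`: every `z ∈ R'` is `r + ∑ x'ⱼ bⱼ` with `r ∈ R`,
`bⱼ ∈ R'`, and if `v(z) < 1` then `v(r) < 1`, so `r ∈ (x)R ⊆ (x')R'`. [folklore] -/
theorem perron_span_eq_centre {n n' : ℕ} (R : Subalgebra k K) (hRO : R.toSubring ≤ O.toSubring)
    (x : Fin n → K) (hx : ∀ i, x i ∈ R)
    (hcen : Ideal.span (Set.range fun i => (⟨x i, hx i⟩ : R.toSubring)) =
      Ideal.comap (Subring.inclusion hRO) (maximalIdeal O))
    (x' : Fin n' → K) (R' : Subalgebra k K)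
    (hR' : R' = Algebra.adjoin k ((R : Set K) ∪ Set.range x'))
    (hR'O : R'.toSubring ≤ O.toSubring) (hRR' : R ≤ R') (hx' : ∀ j, x' j ∈ R')
    (hv' : ∀ j, O.valuation (x' j) < 1)
    (hxJ : ∀ i, (⟨x i, hRR' (hx i)⟩ : R'.toSubring) ∈
      Ideal.span (Set.range fun j => (⟨x' j, hx' j⟩ : R'.toSubring))) :
    Ideal.span (Set.range fun j => (⟨x' j, hx' j⟩ : R'.toSubring)) =
      Ideal.comap (Subring.inclusion hR'O) (maximalIdeal O) := by
  classical
  set J := Ideal.span (Set.range fun j => (⟨x' j, hx' j⟩ : R'.toSubring)) with hJ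
  apply le_antisymm
  · rw [Ideal.span_le]
    rintro _ ⟨j, rfl⟩
    exact (perron_mem_centre_iff O R' hR'O (hx' j)).mpr (hv' j)
  · rintro ⟨z, hz⟩ hzc
    have hvz : O.valuation z < 1 := (perron_mem_centre_iff O R' hR'O hz).mp hzc
    -- every element of `R' = R[x']` is `r + ∑ x'ⱼ bⱼ` with `r ∈ R`, `bⱼ ∈ R'`
    have key : ∀ w, w ∈ Algebra.adjoin k ((R : Set K) ∪ Set.range x') →
        ∃ r ∈ R, ∃ b : Fin n' → K, (∀ j, b j ∈ R') ∧ w = r + ∑ j, x' j * b j := by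
      intro w hw
      induction hw using Algebra.adjoin_induction with
      | mem w hw =>
        rcases hw with hw | ⟨j, rfl⟩
        · exact ⟨w, hw, 0, fun _ => R'.zero_mem, by simp⟩
        · refine ⟨0, R.zero_mem, Pi.single j 1, fun j' => ?_, ?_⟩
          · rw [Pi.single_apply]
            split_ifs
            exacts [R'.one_mem, R'.zero_mem]
          · simp only [Pi.single_apply, mul_ite, mul_one, mul_zero, Finset.sum_ite_eq',
              Finset.mem_univ, if_true, zero_add]
      | algebraMap c =>
        exact ⟨algebraMap k K c, R.algebraMap_mem c, 0, fun _ => R'.zero_mem, by simp⟩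
      | add w₁ w₂ _ _ ih₁ ih₂ =>
        obtain ⟨r₁, hr₁, b₁, hb₁, h₁⟩ := ih₁
        obtain ⟨r₂, hr₂, b₂, hb₂, h₂⟩ := ih₂
        refine ⟨r₁ + r₂, R.add_mem hr₁ hr₂, b₁ + b₂, fun j => R'.add_mem (hb₁ j) (hb₂ j), ?_⟩
        rw [h₁, h₂]
        simp only [Pi.add_apply, mul_add, Finset.sum_add_distrib]
        ring
      | mul w₁ w₂ _ hw₂ ih₁ ih₂ =>
        obtain ⟨r₁, hr₁, b₁, hb₁, h₁⟩ := ih₁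
        obtain ⟨r₂, hr₂, b₂, hb₂, h₂⟩ := ih₂
        have hw₂' : w₂ ∈ R' := by rw [hR']; exact hw₂
        refine ⟨r₁ * r₂, R.mul_mem hr₁ hr₂, fun j => b₁ j * w₂ + r₁ * b₂ j,
          fun j => R'.add_mem (R'.mul_mem (hb₁ j) hw₂') (R'.mul_mem (hRR' hr₁) (hb₂ j)), ?_⟩
        have e1 : ∑ j, x' j * (b₁ j * w₂ + r₁ * b₂ j) =
            (∑ j, x' j * b₁ j) * w₂ + r₁ * ∑ j, x' j * b₂ j := by
          rw [Finset.sum_mul, Finset.mul_sum, ← Finset.sum_add_distrib]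
          exact Finset.sum_congr rfl fun j _ => by ring
        rw [e1]
        linear_combination w₂ * h₁ + r₁ * h₂
    have hz' : z ∈ Algebra.adjoin k ((R : Set K) ∪ Set.range x') := by rw [← hR']; exact hz
    obtain ⟨r, hr, b, hb, hzr⟩ := key z hz'
    have hvsum : O.valuation (∑ j, x' j * b j) < 1 := by
      refine Valuation.map_sum_lt _ one_ne_zero fun j _ => ?_
      rw [map_mul]
      exact lt_of_le_of_lt
        (mul_le_of_le_one_right' ((O.valuation_le_one_iff _).mpr (hR'O (hb j)))) (hv' j)
    have hvr : O.valuation r < 1 := by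
      rw [eq_sub_of_add_eq hzr.symm]
      exact lt_of_le_of_lt (Valuation.map_sub _ _ _) (max_lt hvz hvsum)
    obtain ⟨c, hc, hrc⟩ := perron_exists_coeffs O R hRO x hx hcen hr hvr
    have hzeq : (⟨z, hz⟩ : R'.toSubring) =
        ∑ i, (⟨x i, hRR' (hx i)⟩ : R'.toSubring) * ⟨c i, hRR' (hc i)⟩ +
          ∑ j, (⟨x' j, hx' j⟩ : R'.toSubring) * ⟨b j, hb j⟩ := by
      apply Subtype.ext
      push_cast
      rw [hzr, hrc]
    rw [hzeq]
    exact J.add_mem (Ideal.sum_mem _ fun i _ => J.mul_mem_right _ (hxJ i))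
      (Ideal.sum_mem _ fun j _ => J.mul_mem_right _ (Ideal.subset_span ⟨j, rfl⟩))

/-- **Value independence survives a unimodular monomial change of parameters**: if
`x'ⱼ = ∏ xᵢ ^ C j i` with `C` invertible over `ℤ`, then `ℤ`-independence of the `v(xᵢ)` gives
`ℤ`-independence of the `v(x'ⱼ)`. [folklore] -/
theorem perron_valIndep_of_matrix {n : ℕ} (x : Fin n → K) (hx0 : ∀ i, x i ≠ 0)
    (hind : ∀ m : Fin n → ℤ, (∏ i, O.valuation (x i) ^ (m i)) = 1 → m = 0)
    (C D : Matrix (Fin n) (Fin n) ℤ) (hCD : C * D = 1) (x' : Fin n → K)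
    (hx' : ∀ j, x' j = ∏ i, x i ^ (C j i)) :
    ∀ m : Fin n → ℤ, (∏ j, O.valuation (x' j) ^ (m j)) = 1 → m = 0 := by
  -- adapted from `knafKuhlmann2005_thm41_field` (AbhyankarRationalUniformization.lean)
  intro m hm
  have key : (∏ j, O.valuation (x' j) ^ (m j)) =
      ∏ i, O.valuation (x i) ^ ((∑ j, m j • C j) i) := by
    rw [← valuation_prod_zpow x O, prod_zpow_sum x hx0, map_prod]
    refine Finset.prod_congr rfl fun j _ => ?_
    rw [prod_zpow_zsmul, map_zpow₀, hx']
  have h0 := hind (∑ j, m j • C j) (by rw [← key]; exact hm)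
  funext k'
  have hk : m k' = ∑ i, (∑ j, m j • C j) i * D i k' := by
    have hmul : ∀ j, (∑ i, m j * C j i * D i k') = m j * (C * D) j k' := fun j => by
      rw [Matrix.mul_apply, Finset.mul_sum]
      exact Finset.sum_congr rfl fun i _ => by ring
    simp only [Finset.sum_apply, Pi.smul_apply, smul_eq_mul, Finset.sum_mul]
    rw [Finset.sum_comm]
    simp only [hmul, hCD, Matrix.one_apply, mul_ite, mul_one, mul_zero, Finset.sum_ite_eq',
      Finset.mem_univ, if_true]
  rw [hk, h0]
  simp

/-- A Laurent monomial `x^h` whose exponent is an `ℕ`-combination `h = ∑ eⱼ Cⱼ` of the rows of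
`C` is the ordinary monomial `∏ x'ⱼ ^ eⱼ` in `x'ⱼ = x^{Cⱼ}`. [folklore] -/
theorem perron_prod_zpow_eq_prod_pow {n : ℕ} (x : Fin n → K) (hx0 : ∀ i, x i ≠ 0)
    (C : Matrix (Fin n) (Fin n) ℤ) (x' : Fin n → K) (hx' : ∀ j, x' j = ∏ i, x i ^ (C j i))
    (h : Fin n → ℤ) (e : Fin n → ℕ) (he : ∀ i, h i = ∑ j, (e j : ℤ) * C j i) :
    (∏ i, x i ^ (h i)) = ∏ j, x' j ^ (e j) := by
  have hsum : h = ∑ j, (e j : ℤ) • C j := by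
    funext i
    rw [he i]
    simp only [Finset.sum_apply, Pi.smul_apply, smul_eq_mul]
  rw [hsum, prod_zpow_sum x hx0]
  refine Finset.prod_congr rfl fun j _ => ?_
  rw [prod_zpow_zsmul, zpow_natCast, hx']

/-- **Monomial times unit** (Step 7 of Zariski–Perron). From the dominant form
`a = ∑ c_μ x^μ` (`perron_exists_dominant`) and new parameters `x'` in which `x^{μ₀}` and all
`x^{μ − μ₀}` are ordinary monomials, `a = x'^α · u` with `u = ∑ c_μ x^{μ − μ₀} ∈ R'` of value `1`
(the term `μ = μ₀` has value `1`, the others `< 1`). [folklore] -/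
theorem perron_exists_monomial_mul_unit {n n' : ℕ} (R R' : Subalgebra k K)
    (hRO : R.toSubring ≤ O.toSubring) (hRR' : R ≤ R')
    (x : Fin n → K) (hx0 : ∀ i, x i ≠ 0) (x' : Fin n' → K) (hx' : ∀ j, x' j ∈ R')
    {a : K} (P : MvPolynomial (Fin n) K) (μ₀ : Fin n →₀ ℕ) (hμ₀ : μ₀ ∈ P.support)
    (hPR : ∀ μ, P.coeff μ ∈ R) (hv1 : O.valuation (P.coeff μ₀) = 1)
    (hdom : ∀ μ ∈ P.support, μ ≠ μ₀ →
      (∏ i, O.valuation (x i) ^ (μ i)) < ∏ i, O.valuation (x i) ^ (μ₀ i))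
    (hPe : MvPolynomial.eval x P = a)
    (α : Fin n' → ℕ) (hα : (∏ i, x i ^ (μ₀ i : ℤ)) = ∏ j, x' j ^ (α j))
    (hdiff : ∀ μ ∈ P.support, ∃ e : Fin n' → ℕ,
      (∏ i, x i ^ ((μ i : ℤ) - μ₀ i)) = ∏ j, x' j ^ (e j)) :
    ∃ (α : Fin n' → ℕ) (u : K), u ∈ R' ∧ O.valuation u = 1 ∧
      a = (∏ j, x' j ^ (α j)) * u := by
  classical
  set u := ∑ μ ∈ P.support, P.coeff μ * ∏ i, x i ^ ((μ i : ℤ) - μ₀ i) with hu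
  -- `x^μ = x^{μ₀} · x^{μ - μ₀}`
  have hmon : ∀ μ : Fin n →₀ ℕ, (∏ i, x i ^ (μ i)) =
      (∏ i, x i ^ (μ₀ i : ℤ)) * ∏ i, x i ^ ((μ i : ℤ) - μ₀ i) := by
    intro μ
    rw [← Finset.prod_mul_distrib]
    refine Finset.prod_congr rfl fun i _ => ?_
    rw [← zpow_add₀ (hx0 i), add_sub_cancel, zpow_natCast]
  have hg0 : (∏ i, x i ^ ((μ₀ i : ℤ) - μ₀ i)) = 1 := by simp
  have hvlt : ∀ μ ∈ P.support, μ ≠ μ₀ →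
      O.valuation (∏ i, x i ^ ((μ i : ℤ) - μ₀ i)) < 1 := by
    intro μ hμ hne
    have h2 : O.valuation (∏ i, x i ^ (μ i)) < O.valuation (∏ i, x i ^ (μ₀ i)) := by
      simpa only [map_prod, map_pow] using hdom μ hμ hne
    rw [hmon μ, hmon μ₀, hg0, mul_one, map_mul] at h2
    exact lt_of_mul_lt_mul_left' (h2.trans_eq (mul_one _).symm)
  refine ⟨α, u, ?_, ?_, ?_⟩
  · refine Subalgebra.sum_mem _ fun μ hμ => Subalgebra.mul_mem _ (hRR' (hPR μ)) ?_
    obtain ⟨e, he⟩ := hdiff μ hμ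
    rw [he]
    exact Subalgebra.prod_mem _ fun j _ => Subalgebra.pow_mem _ (hx' j) _
  · rw [hu, O.valuation.map_sum_eq_of_lt hμ₀]
    · rw [map_mul, hv1, hg0, map_one, mul_one]
    · intro μ hμ
      rw [Finset.mem_sdiff, Finset.mem_singleton] at hμ
      rw [map_mul, map_mul, hv1, hg0, map_one, mul_one]
      exact lt_of_le_of_lt
        (mul_le_of_le_one_left' ((O.valuation_le_one_iff _).mpr (hRO (hPR μ)))) (hvlt μ hμ.1 hμ.2)
  · rw [← hPe, MvPolynomial.eval_eq', ← hα, hu, Finset.mul_sum]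
    refine Finset.sum_congr rfl fun μ _ => ?_
    rw [hmon μ]
    ring

end Chart

/-! ### The stub -/

/-- **Perron monomialization on a very good chart, rank one** (stub S3 of the line
`pfaff-line-log-final-forms`; Zariski–Perron, = Cutkosky 2022 Thm. 1.2 (1) without completions).
Given a very good chart `(R, x)` of `K/k` along `O` (centre generated by the non-zero `xᵢ`,
`ℤ`-independent values) with archimedean value group, finitely many non-zero `aⱼ ∈ R` and
finitely many Laurent exponents `h_l` with `v(x^{h_l}) ≤ 1`, there is a very good chart
`(R' = R[x'], x')`, `R ≤ R' ⊆ Frac R`, with the `xᵢ` monomials in the `x'ⱼ`, every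
`aⱼ = x'^{αⱼ} · uⱼ` with `uⱼ ∈ R'` of value `1`, and every `x^{h_l}` a monomial in `x'`.
Proof: dominant forms `aⱼ = ∑ c_μ x^μ` (`stub_perronDominantTerm`); Knaf–Kuhlmann 2005
Lemma 4.2 (`knafKuhlmann2005_lemma42_matrix`) applied to `τ = v ∘ x` and the finite set of the
differences `μ − μ₀ⱼ`, the `μ₀ⱼ`, the `h_l` and the unit vectors gives `C ∈ GLₙ(ℤ)` with
`v(x^{Cⱼ}) < 1` making all of them `ℕ`-combinations of the rows; `x'ⱼ := x^{Cⱼ}`,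
`R' := k[R, x']` (`≤ O`, finitely generated, inside `Frac R`); the centre of `R'` is `(x')`
(`perron_span_eq_centre`), the `v(x'ⱼ)` are `ℤ`-independent (`perron_valIndep_of_matrix`), and
`aⱼ = x^{μ₀ⱼ} · ∑ c_μ x^{μ − μ₀ⱼ}` (`perron_exists_monomial_mul_unit`).
[cite: Cutkosky2022, Thm. 1.2 (1)] -/
theorem stub_perronMonomialization :
    ∀ (k K : Type) [Field k] [Field K] [Algebra k K] (O : ValuationSubring K) (n : ℕ) (R : Subalgebra k K) (hRO : R.toSubring ≤ O.toSubring) (x : Fin n → K) (hx : ∀ i, x i ∈ R), R.FG → (∀ i, x i ≠ 0) → Ideal.span (Set.range fun i => (⟨x i, hx i⟩ : R.toSubring)) = Ideal.comap (Subring.inclusion hRO) (IsLocalRing.maximalIdeal O) → (∀ m : Fin n → ℤ, (∏ i, O.valuation (x i) ^ (m i)) = 1 → m = 0) → (∀ z w : K, O.valuation z < 1 → w ≠ 0 → ∃ N : ℕ, O.valuation z ^ N < O.valuation w) → ∀ (m : ℕ) (a : Fin m → K), (∀ j, a j ∈ R ∧ a j ≠ 0) → ∀ (l : ℕ) (h :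 Fin l → Fin n → ℤ), (∀ j, (∏ i, O.valuation (x i) ^ (h j i)) ≤ 1) → ∃ (R' : Subalgebra k K) (hR'O : R'.toSubring ≤ O.toSubring) (x' : Fin n → K) (hx' : ∀ i, x' i ∈ R'), R ≤ R' ∧ R'.FG ∧ ((R' : Set K) ⊆ Subfield.closure (R : Set K)) ∧ (∀ i, x' i ≠ 0) ∧ Ideal.span (Set.range fun i => (⟨x' i, hx' i⟩ : R'.toSubring)) = Ideal.comap (Subring.inclusion hR'O) (IsLocalRing.maximalIdeal O) ∧ (∀ m : Fin n → ℤ, (∏ i, O.valuation (x' i) ^ (m i)) = 1 → m = 0) ∧ (∀ i, ∃ d : Fin n → ℕ, x i = ∏ j, x' j ^ (d j)) ∧ (∀ j, ∃ (α : Fin n → ℕ) (u : K), u ∈ R' ∧ O.valuation u = 1 ∧ a j = (∏ i, x' i ^ (α i)) * u) ∧ (∀ j, ∃ e : Fin n → ℕ, (∏ i, x i ^ (h j i)) = ∏ i, x' i ^ (e i)) := by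
  intro k K _ _ _ O n R hRO x hx hRFG hx0 hcen hind harch m a ha l h hh
  classical
  have hvx0 : ∀ i, O.valuation (x i) ≠ 0 := fun i => (map_ne_zero O.valuation).mpr (hx0 i)
  have hxlt : ∀ i, O.valuation (x i) < 1 := fun i =>
    (perron_mem_centre_iff O R hRO (hx i)).mp (by rw [← hcen]; exact Ideal.subset_span ⟨i, rfl⟩)
  -- Steps 1–2: dominant forms of the `a j`
  have hDF := fun j =>
    stub_perronDominantTerm k K O n R hRO x hx hx0 hcen hind harch (a j) (ha j).1 (ha j).2
  choose P μ₀ hμ₀ hPR hv1 hdom hPe using hDF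
  -- Step 3: the finite set of exponent vectors handed to Knaf–Kuhlmann's Lemma 4.2
  let H : Finset (Fin n → ℤ) :=
    (Finset.univ.biUnion fun j => (P j).support.image
        fun μ => fun i => (μ i : ℤ) - (μ₀ j i : ℤ)) ∪
      (Finset.univ.image fun j => fun i => (μ₀ j i : ℤ)) ∪
      (Finset.univ.image h) ∪
      (Finset.univ.image fun i => (Pi.single i 1 : Fin n → ℤ))
  have hH1 : ∀ j, ∀ μ ∈ (P j).support, (fun i => (μ i : ℤ) - (μ₀ j i : ℤ)) ∈ H := by
    intro j μ hμ
    simp only [H, Finset.mem_union, Finset.mem_biUnion, Finset.mem_image, Finset.mem_univ,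
      true_and]
    exact Or.inl (Or.inl (Or.inl ⟨j, μ, hμ, rfl⟩))
  have hH2 : ∀ j, (fun i => (μ₀ j i : ℤ)) ∈ H := by
    intro j
    simp only [H, Finset.mem_union, Finset.mem_biUnion, Finset.mem_image, Finset.mem_univ,
      true_and]
    exact Or.inl (Or.inl (Or.inr ⟨j, rfl⟩))
  have hH3 : ∀ j, h j ∈ H := by
    intro j
    simp only [H, Finset.mem_union, Finset.mem_biUnion, Finset.mem_image, Finset.mem_univ,
      true_and]
    exact Or.inl (Or.inr ⟨j, rfl⟩)
  have hH4 : ∀ i, (Pi.single i 1 : Fin n → ℤ) ∈ H := by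
    intro i
    simp only [H, Finset.mem_union, Finset.mem_biUnion, Finset.mem_image, Finset.mem_univ,
      true_and]
    exact Or.inr ⟨i, rfl⟩
  have hH : ∀ g ∈ H, (∏ i, O.valuation (x i) ^ (g i)) ≤ 1 := by
    intro g hg
    simp only [H, Finset.mem_union, Finset.mem_biUnion, Finset.mem_image, Finset.mem_univ,
      true_and] at hg
    rcases hg with ((⟨j, μ, hμ, rfl⟩ | ⟨j, rfl⟩) | ⟨j, rfl⟩) | ⟨i, rfl⟩
    · have hle : (∏ i, O.valuation (x i) ^ (μ i)) ≤ ∏ i, O.valuation (x i) ^ (μ₀ j i) := by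
        by_cases hne : μ = μ₀ j
        · rw [hne]
        · exact (hdom j μ hμ hne).le
      have heq : (∏ i, O.valuation (x i) ^ ((μ i : ℤ) - (μ₀ j i : ℤ))) =
          (∏ i, O.valuation (x i) ^ (μ i)) / ∏ i, O.valuation (x i) ^ (μ₀ j i) := by
        rw [← Finset.prod_div_distrib]
        refine Finset.prod_congr rfl fun i _ => ?_
        rw [zpow_sub₀ (hvx0 i), zpow_natCast, zpow_natCast]
      rw [heq]
      exact div_le_one_of_le₀ hle zero_le
    · simp only [zpow_natCast]
      exact Finset.prod_le_one' fun i _ => pow_le_one' (hxlt i).le _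
    · exact hh j
    · rw [← valuation_prod_zpow x O, prod_zpow_single]
      exact (hxlt i).le
  obtain ⟨C, D, hCD, -, hpos, hexp⟩ :=
    knafKuhlmann2005_lemma42_matrix O.ValueGroup n (fun i => O.valuation (x i)) hvx0 hind H hH
  -- Step 4: the new parameters `x'ⱼ = x^{Cⱼ}`
  set x' : Fin n → K := fun j => ∏ i, x i ^ (C j i) with hx'def
  have hx'j : ∀ j, x' j = ∏ i, x i ^ (C j i) := fun j => rfl
  have hvx' : ∀ j, O.valuation (x' j) = ∏ i, O.valuation (x i) ^ (C j i) := fun j =>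
    valuation_prod_zpow x O (C j)
  have hx'lt : ∀ j, O.valuation (x' j) < 1 := fun j => by rw [hvx']; exact hpos j
  have hx'0 : ∀ j, x' j ≠ 0 := fun j => prod_zpow_ne_zero x hx0 _
  have hmono : ∀ g ∈ H, ∃ e : Fin n → ℕ, (∏ i, x i ^ (g i)) = ∏ j, x' j ^ (e j) := by
    intro g hg
    obtain ⟨e, he⟩ := hexp g hg
    exact ⟨e, perron_prod_zpow_eq_prod_pow x hx0 C x' hx'j g e he⟩
  -- the ring `R' = R[x']`
  let R' : Subalgebra k K := Algebra.adjoin k ((R : Set K) ∪ Set.range x')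
  have hRR' : R ≤ R' := fun z hz => Algebra.subset_adjoin (Or.inl hz)
  have hx'R' : ∀ j, x' j ∈ R' := fun j => Algebra.subset_adjoin (Or.inr ⟨j, rfl⟩)
  let OK : Subalgebra k K :=
    { O.toSubring with algebraMap_mem' := fun c => hRO (R.algebraMap_mem c) }
  have hR'OK : R' ≤ OK := by
    refine Algebra.adjoin_le ?_
    rintro z (hz | ⟨j, rfl⟩)
    · exact hRO hz
    · exact (O.valuation_le_one_iff _).mp (hx'lt j).le
  have hR'O : R'.toSubring ≤ O.toSubring := fun z hz => hR'OK hz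
  let FK : Subalgebra k K :=
    { (Subfield.closure (R : Set K)).toSubring with
      algebraMap_mem' := fun c => Subfield.subset_closure (R.algebraMap_mem c) }
  have hR'FK : R' ≤ FK := by
    refine Algebra.adjoin_le ?_
    rintro z (hz | ⟨j, rfl⟩)
    · exact Subfield.subset_closure hz
    · exact prod_zpow_mem x (fun i => Subfield.subset_closure (hx i)) (C j)
  have hsub : (R' : Set K) ⊆ Subfield.closure (R : Set K) := fun z hz => hR'FK hz
  have hFG : R'.FG := by
    obtain ⟨s, hs⟩ := hRFG
    refine ⟨s ∪ Finset.univ.image x', ?_⟩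
    rw [Finset.coe_union, Finset.coe_image, Finset.coe_univ, Set.image_univ,
      Algebra.adjoin_union, hs]
    show R ⊔ Algebra.adjoin k (Set.range x') = Algebra.adjoin k ((R : Set K) ∪ Set.range x')
    rw [Algebra.adjoin_union, Algebra.adjoin_eq]
  -- the old parameters are monomials in the new ones
  have hxd : ∀ i, ∃ d : Fin n → ℕ, x i = ∏ j, x' j ^ (d j) := by
    intro i
    obtain ⟨e, he⟩ := hmono _ (hH4 i)
    rw [prod_zpow_single] at he
    exact ⟨e, he⟩
  -- Step 5: the centre of `R'`
  have hxJ : ∀ i, (⟨x i, hRR' (hx i)⟩ : R'.toSubring) ∈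
      Ideal.span (Set.range fun j => (⟨x' j, hx'R' j⟩ : R'.toSubring)) := by
    intro i
    obtain ⟨d, hd⟩ := hxd i
    have hd0 : d ≠ 0 := by
      rintro rfl
      simp only [Pi.zero_apply, pow_zero, Finset.prod_const_one] at hd
      exact (hxlt i).ne (by rw [hd, map_one])
    obtain ⟨j, hj⟩ := Function.ne_iff.mp hd0
    have heq : (⟨x i, hRR' (hx i)⟩ : R'.toSubring) =
        ∏ j, (⟨x' j, hx'R' j⟩ : R'.toSubring) ^ (d j) :=
      Subtype.ext (by push_cast; exact hd)
    rw [heq]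
    exact perron_prod_pow_mem_span _ d hj
  have hcentre := perron_span_eq_centre O R hRO x hx hcen x' R' rfl hR'O hRR' hx'R' hx'lt hxJ
  -- Step 6: value independence of `x'`
  have hind' := perron_valIndep_of_matrix O x hx0 hind C D hCD x' hx'j
  -- Step 7: the `a j`
  have haj : ∀ j, ∃ (α : Fin n → ℕ) (u : K), u ∈ R' ∧ O.valuation u = 1 ∧
      a j = (∏ i, x' i ^ (α i)) * u := by
    intro j
    obtain ⟨α, hα⟩ := hmono _ (hH2 j)
    refine perron_exists_monomial_mul_unit O R R' hRO hRR' x hx0 x' hx'R' (P j) (μ₀ j) (hμ₀ j)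
      (hPR j) (hv1 j) (hdom j) (hPe j) α hα fun μ hμ => ?_
    obtain ⟨e, he⟩ := hmono _ (hH1 j μ hμ)
    exact ⟨e, he⟩
  have hhj : ∀ j, ∃ e : Fin n → ℕ, (∏ i, x i ^ (h j i)) = ∏ i, x' i ^ (e i) := fun j =>
    hmono _ (hH3 j)
  exact ⟨R', hR'O, x', hx'R', hRR', hFG, hsub, hx'0, hcentre, hind', hxd, haj, hhj⟩

end Summit.ResolutionOfSingularities.ResolutionOfSingularities.Theorems.PfaffLine
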